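import Summits.CriticalPhenomena.PercolationContinuityZ3.Theorems.Transplant.SkelConcFaceInnerRoute
import Summits.CriticalPhenomena.PercolationContinuityZ3.Theorems.Transplant.SkelRouteLaw
import Summits.CriticalPhenomena.PercolationContinuityZ3.Theorems.Transplant.SkelConcExcess
import Summits.CriticalPhenomena.PercolationContinuityZ3.Theorems.Transplant.SkelDeepRoute
import HarnessLib

/-!
# L6 (F) — the ROUTE LAW at a deep face-step contact (generic re-typing of `BoxProdZ2ConcFaceRoute` §2 `innerExc` and of the law half of
# `advRoute_of_contact`, SHEAR-SCOPE §3.9 Layer 6 (F)): under `Skel.routeW G Wt Qt S` (the face law with the contact's inner prism `S` wired,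
# cut to the route world `Qt = Skel.innerQt …`), the rooted regions of the inner run are subboxes of the inner window graph
# `Skel.winGraph G o L_A`, the rim excess of every inner step is `≤ η` (hp-8 g22's `real_rim_le_of_wired_source` with the centre-uniform excess
# radius), and the point-source connection to the far face is dominated by the link event under `Wt`

builds on p205010 (kernel theorem, internal audit signed; external expert review pending) — nothing in this file uses p205010.
Lane `prim-bschramm`, typed by the `prim-hp-8` lineage (gen 24); helper file (`--supports stmt-CriticalPhenomena-4575 --as helper`).
NEW FILE over `SkelConcFaceInnerRoute` (hp-8 g24), `SkelRouteLaw` (hp-8 g24), `SkelConcExcess` (hp-8 g22), `SkelDeepRoute` (p3-g4: `fatSeq` API).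

Setting: `hWD : IsSubbox (winGraph G w₀ R) Wt q Rg` for a region `Rg ⊆ B_G(w₀, R)` (the face-step window), `Wt` vanishing off the edges of `G`;
a contact with cube centre `c`, wired prism `S = Skel.fatSeq Φ hC c m` (the seed scale), source `o ∈ S`, route world
`Qt = Skel.innerQt Φ C x du o L_A … (φ c) ℓ₁ ⊆ Rg`; the inner run `Skel.innerWAD …` (planar `InnerRunOK` + the cube below region `0`).
* §1 `IsSubbox.anti` (any exploration graph: a sub-region of a subbox region is a subbox region), `fatSeq_subset_graphBall_of_mem` (the
  prism within `2 ψ m` of any of its points), `fatSeq_sub_mem_box`;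
* §2 **`isSubbox_routeW_stepDR`** — the rooted regions are subboxes of `routeW` in `winGraph G o L_A`;
* §3 **`innerExc_routeW`** — `P_{routeW}(⋃_{z ∈ Rim k} o ↔ z) ≤ η` from a centre-uniform excess radius `R₁ ≤ L_A − L'_A` (entrance depth `2 ψ m`,
  planar diameter `50 r`); §4 `innerDom_routeW` — `P_{routeW}(⋃_{z ∈ Ft} o ↔ z) ≤ P_{Wt}(linkIn Qt S Ft)`; §5 **`wired_fatSeq_hsrc`** — the first
  hop from the wired prism (any `W'` with weight `1` on the inner prism's edges and `≥ q` on the route prism's edges; p3-g4's `link_seed_center_of_le`).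
The inner kit clauses (`innerKits`, product) and `route_of_contact` follow the L5.9 `kitClause` landing (part B).
[cite: KozmaNitzan2024, §4 Lemma 10 (p. 17: subbox), Lemma 11 (pp. 22–23: Ω, the wired cube), Lemma 12 (p. 24), p. 30 (Step III)]
[cite: MartineauSevero2019, Cor. 2.2]
-/

noncomputable section

open MeasureTheory ProbabilityTheory
open scoped ENNReal Classical

namespace Summit.CriticalPhenomena.PercolationContinuityZ3.Theorems

namespace Transplant

/-! ## §1 Generic supplements -/

namespace KNLevels

variable {V : Type} [DecidableEq V] {Γ : SimpleGraph V} [Γ.LocallyFinite]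

/-- **A sub-region of a subbox region is a subbox region** (any exploration graph): the interior pairs keep their weights, and a vertex of
`D'` with a positive-weight attachment from outside `D'` is on the inner boundary of `D'` (through `D ∖ D'` by `nadj`, through the outside of
`D` by `outside`). [cite: KozmaNitzan2024, §4 p. 17 (subbox), p. 24 (boxes inside subboxes)] -/
theorem IsSubbox.anti {W : Sym2 V → unitInterval} {p : unitInterval} {D D' : Finset V} (h : IsSubbox Γ W p D) (hsub : D' ⊆ D) :
    IsSubbox Γ W p D' := by
  refine ⟨fun u hu v hv huv => h.adj u (hsub hu) v (hsub hv) huv, fun u hu v hv hne huv => h.nadj u (hsub hu) v (hsub hv) hne huv,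
    fun v hv hvb x hx => ?_⟩
  by_cases hxD : x ∈ D
  · have hne : x ≠ v := fun heq => hx (heq ▸ hv)
    refine h.nadj x hxD v (hsub hv) hne fun hadj => hvb ?_
    exact Literature.Probability.LatticeModels.mem_innerBoundary_iff.2 ⟨hv, x, hx, hadj.symm⟩
  · refine h.outside v (hsub hv) (fun hvD => hvb ?_) x hxD
    obtain ⟨-, y, hy, hadj⟩ := Literature.Probability.LatticeModels.mem_innerBoundary_iff.1 hvD
    exact Literature.Probability.LatticeModels.mem_innerBoundary_iff.2 ⟨hv, y, fun hy' => hy (hsub hy'), hadj⟩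

end KNLevels

namespace Skel

open Literature.Probability.Percolation Literature.Probability.LatticeModels SimpleGraph KNLevels KNCells ChainPlanar
open Literature.Probability.Percolation.KozmaNitzan
open Literature.Probability.Percolation.KozmaNitzan.Cells (oth oth_ne eq_oth_of_ne sgOf sgOf_sign)
open Literature.Barriers.CriticalPhenomena (graphBall graphBall_finite mem_graphBall_self graphBall_mono)
open BoxProdZ2 (ConcRadiiG InnerRunOK innerCtr innerρ)
open Literature.Probability.Percolation.GM (HOct)
open PlanarSkeletonConc

variable {V : Type} [DecidableEq V] [Countable V] {G : SimpleGraph V} [G.LocallyFinite] (Φ : PlanarSkeletonConc G)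

omit [DecidableEq V] in
/-- **A fat prism lies within `2 ψ m` of each of its points.** [folklore] -/
theorem fatSeq_subset_graphBall_of_mem {p : unitInterval} (hC : Φ.toPlanarSkeleton.CylSubcritical p) {c o : V} {m : ℕ}
    (ho : o ∈ fatSeq Φ hC c m) : ∀ s ∈ fatSeq Φ hC c m, s ∈ graphBall G o (2 * fatRadius Φ hC m) := by
  intro s hs
  have h1 : c ∈ graphBall G o (fatRadius Φ hC m) := (BoxProdZ2.mem_graphBall_comm G).1 (mem_graphBall_of_mem_fatSeq Φ hC ho)
  have h2 := BoxProdZ2.mem_graphBall_add G h1 (mem_graphBall_of_mem_fatSeq Φ hC hs)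
  rwa [two_mul]

omit [DecidableEq V] in
/-- The footprints of a fat prism lie in `φ c + Λ_m`. [folklore] -/
theorem fatSeq_sub_mem_box {p : unitInterval} (hC : Φ.toPlanarSkeleton.CylSubcritical p) (c : V) (m : ℕ) :
    ∀ z ∈ fatSeq Φ hC c m, Φ.φ z - Φ.φ c ∈ box 2 m := fun _ hz =>
  (PlanarSkeleton.mem_cyl _ c m _).1 (fatSeq_subset_cyl Φ hC c m (Finset.mem_coe.2 hz))

/-! ## §2 The rooted regions are subboxes of the route law in the inner window graph -/

section Route

variable {C : PCells} {x : Site 2} {du : MDir} {o : V} {L_A L'_A : ℕ} {ca cb q' s₁ : ℤ} {R' ℓ₀ nA Rlev N j₀ j₁ : ℕ} {Sfin : Finset V}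
  {ℓ₁ : ℕ} {j : ℕ}
variable {p : unitInterval} (hC : Φ.toPlanarSkeleton.CylSubcritical p) {c : V} {m : ℕ}
variable {w₀ : V} {R : ℕ} {Wt : Sym2 V → unitInterval} {q : unitInterval} {Rg : Finset V}
variable (hWD : IsSubbox (winGraph G w₀ R) Wt q Rg) (hRg : ∀ u ∈ Rg, u ∈ graphBall G w₀ R) (hWG : ∀ e, e ∉ G.edgeSet → Wt e = 0)
variable (hQ : innerQt Φ C x du o L_A s₁ R' nA ca cb q' (Φ.φ c) ℓ₁ ⊆ Rg)
variable (h : InnerRunOK C j s₁ R' ℓ₀ nA ca cb q') (hsep : C.lev du x (Φ.φ c) + m < ca - (s₁ + 2 * R'))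

include hWD hRg hWG hQ h hsep in
/-- **The rooted regions `k ≤ nA` are subboxes of the route law `routeW Wt Qt S` in the inner window graph `winGraph G o L_A`**
(`S = fatSeq c m`, the cube's planar shadow below region `0`). [cite: KozmaNitzan2024, §4 p. 17 (subbox), Lemma 11 (p. 22: Ω minus the wired cube)] -/
theorem isSubbox_routeW_stepDR {k : ℕ} (hk : k ≤ nA) :
    IsSubbox (winGraph G o L_A) (routeW G Wt (innerQt Φ C x du o L_A s₁ R' nA ca cb q' (Φ.φ c) ℓ₁) (fatSeq Φ hC c m)) q
      ((innerWAD Φ C x du o L_A L'_A ca cb q' s₁ R' ℓ₀ nA Rlev N j₀ j₁ Sfin).stepDR Φ k) := by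
  have hDQ := stepDR_subset_innerQt Φ (C := C) (x := x) (du := du) (o := o) (L_A := L_A) (L'_A := L'_A) (ca := ca) (cb := cb)
    (q' := q') (s₁ := s₁) (R' := R') (ℓ₀ := ℓ₀) (Rlev := Rlev) (N := N) (j₀ := j₀) (j₁ := j₁) (Sfin := Sfin) hk (Φ.φ c) ℓ₁
  refine isSubbox_routeW G hWG hDQ (fun u hu => mem_graphBall_of_mem_innerQt Φ hu) (fun u hu => hRg u (hQ (hDQ hu)))
    (disjoint_stepDR_of_sub_mem_box Φ h hk hsep (fatSeq_sub_mem_box Φ hC c m)) (hWD.anti ((hDQ.trans hQ)))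

/-! ## §3 The rim excess of every inner step under the route law -/

include hWD hRg hQ h hsep in
/-- **The rim excess of the inner step `k ≤ nA` under the route law is `≤ η`**: the route world `Qt` is a subbox region of `Wt` (inside
`Rg`), the wired prism `S = fatSeq c m ∋ o` lies in `Qt` within depth `2 ψ m` of `o`, the rim part `Rim k` (the region beyond depth `L_A − L'_A`
from `o`) misses `S`, and `R₁ ≤ L_A − L'_A` is a centre-uniform excess radius at the running parameter for entrance depth `2 ψ m` and planar
diameter `50 r` (`Skel.exists_excess_radius_uniform`). [cite: KozmaNitzan2024, §4 Lemma 11 (p. 22), Lemma 12 (p. 24)] [cite: MartineauSevero2019, Cor. 2.2] -/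
theorem innerExc_routeW (ho : o ∈ fatSeq Φ hC c m) (hSQ : fatSeq Φ hC c m ⊆ innerQt Φ C x du o L_A s₁ R' nA ca cb q' (Φ.φ c) ℓ₁)
    (hQfar : innerQtPl C x du s₁ R' nA ca cb q' (Φ.φ c) ℓ₁ ⊆ C.farAS x du j) {η : ℝ} {R₁ : ℕ}
    (hR₁ : ∀ (c' : V) (R'' : ℕ), R₁ ≤ R'' → ∀ (Rw : ℕ) (D' A' : Finset V), (∀ d ∈ D', d ∈ graphBall G c' Rw) →
      (∀ d ∈ D', ∀ d' ∈ D', Φ.φ d - Φ.φ d' ∈ box 2 (50 * C.r)) → A' ⊆ D' → (∀ a ∈ A', a ∈ graphBall G c' (2 * fatRadius Φ hC m)) →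
        (bondPercolation G q).real (excess G c' R'' D' A') ≤ η)
    (hR : R₁ ≤ L_A - L'_A) {k : ℕ} (hk : k ≤ nA) :
    (prodBernoulli (routeW G Wt (innerQt Φ C x du o L_A s₁ R' nA ca cb q' (Φ.φ c) ℓ₁) (fatSeq Φ hC c m))).real
      (⋃ z ∈ (innerWAD Φ C x du o L_A L'_A ca cb q' s₁ R' ℓ₀ nA Rlev N j₀ j₁ Sfin).Rim k, openConn o z) ≤ η := by
  have hDQ := stepDR_subset_innerQt Φ (C := C) (x := x) (du := du) (o := o) (L_A := L_A) (L'_A := L'_A) (ca := ca) (cb := cb)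
    (q' := q') (s₁ := s₁) (R' := R') (ℓ₀ := ℓ₀) (Rlev := Rlev) (N := N) (j₀ := j₀) (j₁ := j₁) (Sfin := Sfin) hk (Φ.φ c) ℓ₁
  have hRimD := innerWAD_Rim_subset Φ (C := C) (x := x) (du := du) (o := o) (L_A := L_A) (L'_A := L'_A) (ca := ca) (cb := cb)
    (q' := q') (s₁ := s₁) (R' := R') (ℓ₀ := ℓ₀) (nA := nA) (Rlev := Rlev) (N := N) (j₀ := j₀) (j₁ := j₁) (Sfin := Sfin) k
  -- hp-8 g22's wired-source excess lemma is stated with the classical `DecidableEq`; bridge by subsingleton-ness of instances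
  have hWQ : @KNLevels.IsSubbox V (fun a b => Classical.propDecidable (a = b)) (winGraph G w₀ R) _ Wt q
      (innerQt Φ C x du o L_A s₁ R' nA ca cb q' (Φ.φ c) ℓ₁) := by
    convert hWD.anti hQ
  have hSR : Disjoint (fatSeq Φ hC c m) ((innerWAD Φ C x du o L_A L'_A ca cb q' s₁ R' ℓ₀ nA Rlev N j₀ j₁ Sfin).Rim k) :=
    (disjoint_stepDR_of_sub_mem_box Φ h hk hsep (fatSeq_sub_mem_box Φ hC c m)).mono_right hRimD
  have key := real_rim_le_of_wired_source Φ hWQ (fun u hu => hRg u (hQ hu)) hSQ (hRimD.trans hDQ) hSR ho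
    (c := o) (r₁ := L_A - L'_A) (fun t ht => (Finset.mem_filter.1 ht).2) (fatSeq_subset_graphBall_of_mem Φ hC ho) hR₁ hR
    (Rw := L_A) (fun d hd => mem_graphBall_of_mem_innerQt Φ hd) (fun d hd d' hd' => sub_mem_box_of_mem_innerQt Φ hQfar hd hd')
    (F₀ := ↑(edgesIn G (fatSeq Φ hC c m))) (coe_edgesIn_subset_wireSet G _) ↑(edgesIn G (fatSeq Φ hC c m))
  unfold routeW
  convert key using 2

/-! ## §4 Domination of the point-source connection by the link event -/

omit [DecidableEq V] in
/-- **`P_{routeW}(⋃_{z ∈ Ft} o ↔ z) ≤ P_{Wt}(linkIn Qt S Ft)`** for the far face `Ft` off the wired prism (`o ∈ S ⊆ Qt`).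
[cite: KozmaNitzan2024, §4 Lemma 11 (p. 22), p. 24] -/
theorem innerDom_routeW [DecidableEq V] (ho : o ∈ fatSeq Φ hC c m)
    (hSQ : fatSeq Φ hC c m ⊆ innerQt Φ C x du o L_A s₁ R' nA ca cb q' (Φ.φ c) ℓ₁) {Ft : Finset V} (hSF : Disjoint (fatSeq Φ hC c m) Ft) :
    (prodBernoulli (routeW G Wt (innerQt Φ C x du o L_A s₁ R' nA ca cb q' (Φ.φ c) ℓ₁) (fatSeq Φ hC c m))).real (⋃ z ∈ Ft, openConn o z) ≤
      (prodBernoulli Wt).real (linkIn (↑(innerQt Φ C x du o L_A s₁ R' nA ca cb q' (Φ.φ c) ℓ₁) : Set V) (fatSeq Φ hC c m) Ft) :=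
  real_biUnion_openConn_routeW_le_linkIn G Wt hSQ hSF ho

/-! ## §5 The first hop from the wired prism -/

omit [DecidableEq V] in
/-- Monotonicity of the real-valued measure along an a.s. inclusion. [folklore] -/
private theorem measureReal_mono_ae'' {α : Type*} [MeasurableSpace α] {μ : Measure α} [IsFiniteMeasure μ] {s t : Set α}
    (h : ∀ᵐ x ∂μ, x ∈ s → x ∈ t) : μ.real s ≤ μ.real t := by
  rw [measureReal_def, measureReal_def]
  exact ENNReal.toReal_mono (measure_ne_top _ _) (measure_mono_ae h)

omit [DecidableEq V] in
/-- **The first hop from a WIRED fat prism** (generic twin of the product's `wired_prism_hsrc`): if `W'` gives weight `1` to the `G`-edges inside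
the inner prism `fatSeq c k` and weight `≥ q` to the `G`-edges inside `fatSeq c ℓ` (`k ≤ ℓ`), the link input at scale `ℓ` at the running parameter
gives `1 − δ < P_{W'}(⋃_{t ∈ T} o ↔ t)` for every `o ∈ fatSeq c k` and every `T` containing the quarter-piece `macroPiece c ℓ (ψ ℓ) g`: the wired
prism is a.s. internally connected (`pathIn_cylBall'`), so a link from it is a connection from `o`.
[cite: KozmaNitzan2024, §4 Lemma 9 (p. 16), Lemma 11 (p. 22: the cube wired to a point)] -/
theorem wired_fatSeq_hsrc {W' : Sym2 V → unitInterval} {k ℓ : ℕ} (hkℓ : k ≤ ℓ)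
    (hge : ∀ u ∈ fatSeq Φ hC c ℓ, ∀ u' ∈ fatSeq Φ hC c ℓ, G.Adj u u' → q ≤ W' s(u, u'))
    (hone : ∀ u ∈ fatSeq Φ hC c k, ∀ u' ∈ fatSeq Φ hC c k, G.Adj u u' → W' s(u, u') = 1) {δ : ℝ} {g : HOct 2}
    (hlink : 1 - δ < (bondPercolation G q).real
      (linkIn (↑(fatSeq Φ hC c ℓ)) (fatSeq Φ hC c k) (macroPiece Φ c ℓ (fatRadius Φ hC ℓ) g)))
    {o' : V} (ho : o' ∈ fatSeq Φ hC c k) {T : Finset V} (hT : macroPiece Φ c ℓ (fatRadius Φ hC ℓ) g ⊆ T) :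
    1 - δ < (prodBernoulli W').real (⋃ t ∈ T, openConn o' t) := by
  set S := fatSeq Φ hC c k with hSdef
  have h1 := link_seed_center_of_le Φ hC hge hlink (Sd := S) subset_rfl hT
  -- the wired prism's edges are a.s. open
  have hae : ∀ᵐ ω ∂prodBernoulli W', ∀ u u', u ∈ (↑S : Set V) → u' ∈ (↑S : Set V) → G.Adj u u' → s(u, u') ∈ ω := by
    have key : ∀ e' : Sym2 V, ∀ᵐ ω ∂prodBernoulli W', W' e' = 1 → e' ∈ ω := by
      intro e'
      by_cases he : W' e' = 1
      · filter_upwards [prodBernoulli_ae_mem_of_eq_one _ he] with ω hω _ using hω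
      · exact Filter.Eventually.of_forall fun ω h' => absurd h' he
    rw [← ae_all_iff] at key
    filter_upwards [key] with ω hω u u' hu hu' hadj
    exact hω _ (hone u (Finset.mem_coe.1 hu) u' (Finset.mem_coe.1 hu') hadj)
  refine lt_of_lt_of_le h1 (measureReal_mono_ae'' ?_)
  filter_upwards [hae] with ω hopen hω
  have hSU : (↑S : Set V) ⊆ ↑(fatSeq Φ hC c ℓ) := Finset.coe_subset.2 (fatSeq_monotone Φ hC c hkℓ)
  have hconn : ∀ s ∈ S, PathIn G (↑S : Set V) o' s := fun s hs => by
    have ho' : o' ∈ Φ.cylBall c k (fatRadius Φ hC k) := (mem_fatSeq_iff Φ hC).1 ho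
    have hs' : s ∈ Φ.cylBall c k (fatRadius Φ hC k) := (mem_fatSeq_iff Φ hC).1 hs
    have hcoe : (↑S : Set V) = Φ.cylBall c k (fatRadius Φ hC k) := by
      ext v; rw [Finset.mem_coe, hSdef, mem_fatSeq_iff]
    rw [hcoe]
    exact pathIn_cylBall' Φ ho' hs'
  have h2 := linkIn_subset_biUnion_openConnIn_of_wired (G := G) hSU hconn hopen hω
  simp only [Set.mem_iUnion, exists_prop] at h2 ⊢
  obtain ⟨t, ht, h3⟩ := h2
  exact ⟨t, ht, DCT16.reachable_of_pathIn (DCT16.pathIn_of_mem_openConnIn h3)⟩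

end Route

end Skel

end Transplant

end Summit.CriticalPhenomena.PercolationContinuityZ3.Theorems

end
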